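import Summits.SmoothPoincare4.SmoothPoincare4.Theses.EntropyRung
import Literature.Geometry.Riemannian.GaussianShrinker
import Literature.Uncategorized.WithoutCompactHomotopy

/-!
# `CompactShrinkerGap` minus closedness is false (negative lemma for crux stmt-SmoothPoincare4-10870)

`EntropyRung.CompactShrinkerGap` with the binder `[CompactSpace M]` and the hypothesis `M ≃ₕ S⁴`
deleted is refuted by the Gaussian shrinker `(ℝ⁴, δ, |x|²/4)`: `Ric + Hess f = δ/2`,
`R + |∇f|² = f`, `∫ e^{-f} dx = 16π² > 32π²√π e^{-3/2}` (`Θ(ℝ⁴) = 1 > Θ(S³×ℝ) = .791`), while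
`ℝ⁴` is not diffeomorphic to `S⁴`. So every proof of the crux must use that `M` is closed
(available from `M ≃ₕ S⁴`, Hatcher 3.29). Refuter negative lemma (cdisprove), supports the crux item.
-/

noncomputable section

namespace Summit.SmoothPoincare4.SmoothPoincare4.Theorems.CompactShrinkerGap.Negative

open scoped Manifold ContDiff ENNReal RealInnerProductSpace ContinuousMap
open MeasureTheory
open Literature.Geometry.Riemannian Literature.Geometry.Lorentzian
open Literature.Geometry.Lorentzian.PseudoRiemannianMetric

/-- **Closedness is load-bearing for `CompactShrinkerGap`**: the Gaussian shrinker on `ℝ⁴`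
satisfies every analytic hypothesis with `∫ e^{-f} = 16π²` above the bar, and `ℝ⁴ ≇ S⁴`
(non-compact vs compact). [cite: CaoHamiltonIlmanen2004, §4] -/
theorem withoutCompactHomotopy_false : ¬ Literature.Uncategorized.WithoutCompactHomotopy := by
  intro h
  have hne := h EuclideanFour (euclideanMetric EuclideanFour) gaussianPotential isRiemannian_euclideanMetric
    contDiff_gaussianPotential.contMDiff
    (fun x X Y ↦ by
      rw [ricci_euclideanMetric, hessian_gaussianPotential, euclideanMetric_apply]
      simp only [LinearMap.zero_apply, zero_add]
      rw [div_eq_inv_mul, one_div]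
      rfl)
    (fun x ↦ by rw [scalarCurvature_euclideanMetric, gradSq_gaussianPotential, zero_add])
    (by
      change ENNReal.ofReal _ < ∫⁻ x, ENNReal.ofReal (Real.exp (-gaussianPotential x)) ∂(riemannianMeasure euclideanFourMetric)
      rw [riemannianMeasure_euclideanFour, lintegral_exp_neg_gaussianPotential]
      exact (ENNReal.ofReal_lt_ofReal_iff (by positivity)).mpr cylinderDensityBound_lt_gaussian)
  obtain ⟨Φ⟩ := hne
  haveI : CompactSpace EuclideanFour := Φ.toHomeomorph.symm.compactSpace
  exact not_compactSpace_iff.mpr (inferInstance : NoncompactSpace EuclideanFour) this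

end Summit.SmoothPoincare4.SmoothPoincare4.Theorems.CompactShrinkerGap.Negative

end
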